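/-
Copyright (c) 2026 the pub-hodgecm-mathlib formalisation cell (harness21).  Prover seat hodgecm-mathlib-K2E3-p23 (g3), Track B «K2-LIT» ∕ h413
(`stmt-HodgeConjecture-24833`), line `K2_E3_EllipticInputs`, 13a road A (line lead K2E3-p10 (g4)), item (P2a) «set-twin of the W7 recursion».  2026-09-04.
-/
import Summits.HodgeConjecture.HodgeConjecture.Theorems.K2E3WittLeviCartanRecursionKernel   -- ★ p856772 (K2E3-p10 (g3)): the `K₀`-currency recursion (pattern); brings ★ LabelsKernel, Blocks, Lift
import Summits.HodgeConjecture.HodgeConjecture.Theorems.K2E3WittBoundedEntryTools            -- (this seat): finite bounds, triple products, bounded inverse in `U(σ, W)`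
import HarnessLib

/-!
# Levi Cartan decomposition of `U(σ, W)`, `W = wittFormOn e Han`, ANY kernel — the recursion over the first `GL` block in COMPACT-SET (bounded) currency, modulo the
# BOUNDED sorted Cartan letter (crux H413, 13a road A, item (P2a) of RULINGS #15: the set-twin of ★ p856772)

Cell `hodgecm-mathlib`, Track B, line `K2_E3_EllipticInputs`, row 13a; seat K2E3-p23 (g3), on K2E3-p10 (g4)'s RULINGS #15 (2) (K2 bus 2026-09-04T02:54:49Z).  THEOREMS
ONLY; count-neutral helper (`--supports stmt-HodgeConjecture-24833 --as helper`).  ★ p856772 `exists_leviIntegral_mul_diagonalGL_mul_kernel` runs the strong induction on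
the Witt index `r` peeling the first `GL` block of a block-diagonal element of `U(σ, W)` in `K₀ = U ∩ GL_N(𝒪)` currency, modulo `hrawW` (★ `K2E3WittCartan.exists_cartan_witt`
for NORMALISED kernels — unavailable at the WILD `m = 2` places, K2E3-p09 (g3) (F-a)).  THIS FILE is the same recursion with `unitaryInt σ W` replaced by «entries of `k`
and `k⁻¹` bounded by `exp b`», `b : ℕ` depending on `(r, e, S)` only, modulo the BOUNDED sorted letter `hrawBs` (the line lead's (P0b) `exists_boundedCartan_sorted`
over K2E3-p09's ★ `hrawΩ` p856917, quantified over every Witt index `r′` and standard `e′`).  The lifts `diag(κ, κ′, κ†)` are bounded by the middle bound `exp b′`, their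
inverses through `L⁻¹ = W⁻¹ σ(L)ᵀ W` (★ `K2E3WittBoundedEntryTools`) by `exp(b′ + 2 c_W)`.
* §1 private label copies (as in ★ p856772).  * §2 **`exists_leviBounded_mul_diagonalGL_mul_kernel`** — `hrawBs ⟹` for every `(r, e, S)` there is `b : ℕ` with every
  `g ∈ U(σ, W) ∩ M_S` equal to `k₁ · diag(d) · k₂`, `k₁, k₂ ∈ M_S`, entries of `k_i^{±1}` bounded by `exp b`, `σ(d_i) d_{rev i} = 1`, `d ≡ 1` on the kernel slots,
  `|d_k| = q^{−E_k}`, `E` antitone on the `S`-blocks, `E ∘ rev = −E` — the statement of ★ p856772 with `unitaryInt` ↦ bounded.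
Hypotheses: `hσ`, `hvσ`, `hϖ` (ANY uniformiser), `hHan : IsUnit Han.det`, `[IsPrincipalIdealRing 𝒪]`.  HONEST LABEL: HC_CM is proved only modulo the 7 printed citations
(2 remaining named inputs: hLiu418 = stmt-HodgeConjecture-24832, h413 = stmt-HodgeConjecture-24833) until rung 0 closes; structure lemma modulo the named bounded letter.
References: Bruhat–Tits (1972) (4.4.3); Tits (1979) §3.3.3; Macdonald (1995) Ch. V §2; Jacobowitz (1962) §§7–8; Bernstein–Zelevinsky (1977) §2.1. -/

set_option autoImplicit false
set_option linter.dupNamespace false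

noncomputable section

open scoped Valued WithZero Matrix MatrixGroups
open Matrix

namespace Summit.HodgeConjecture.HodgeConjecture.Cruxes.H413.K2E3WittLeviCartanRecursionBounded

open Literature.NumberTheory.Automorphic Literature.NumberTheory.Automorphic.HermitianLattice
open Literature.NumberTheory.Automorphic.CartanUnique
open K2E3LocalUnitaryWitt K2E3WittLeviCartanBlocks K2E3WittCartanUnramified K2E3WittLeviCartanLabels K2E3WittLeviCartanRecursionTame
  K2E3WittParabolicBlocks K2E3WittParabolicBlocksLift K2E3WittLeviLabelsKernel K2E3WittBoundedEntryTools

/-! ## §1 The `m`-free label comparison (private copies of ★ `K2E3WittLeviLabelsKernel` §1, which the gate keeps private) -/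

section Labels

variable {r : ℕ} {m : ℕ} {N : ℕ} (e : WittIndex r m ≃ Fin N)
  (hstd : ∀ x, (e x).val = Sum.elim (fun i : Fin r => i.val) (Sum.elim (fun u : Fin m => r + u.val) (fun j : Fin r => r + m + j.val)) x)
  {S : Finset (Fin r)} {α₀ : Fin r} (hα₀ : α₀ ∉ S) (hmin : ∀ α, α ∉ S → α₀ ≤ α)

include hstd hα₀ hmin in
/-- Label `2L` is the last block, any `m`. [cite: Borel1991, §23] -/
private theorem wittBlockNat_eq_two_mul_iff'' (x : WittIndex r m) :
    wittBlockNat S x = 2 * (Finset.univ \ S).card ↔ N ≤ (e x).val + (α₀.val + 1) := by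
  have hN : N = r + (m + r) := by simpa using (Fintype.card_congr e).symm
  have hL : 1 ≤ (Finset.univ \ S).card := Finset.card_pos.2 ⟨α₀, by simp [hα₀]⟩
  have hα₀r := α₀.isLt
  rcases x with i | u | j
  · rw [hstd]; simp only [Sum.elim_inl]
    change ((Finset.univ \ S).filter fun α => α.val < i.val).card = _ ↔ _
    have h1 : ((Finset.univ \ S).filter fun α => α.val < i.val).card ≤ (Finset.univ \ S).card := Finset.card_filter_le _ _
    have := i.isLt
    omega
  · rw [hstd]; simp only [Sum.elim_inr, Sum.elim_inl]
    change (Finset.univ \ S).card = _ ↔ _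
    have := u.isLt
    omega
  · rw [hstd]; simp only [Sum.elim_inr]
    change (Finset.univ \ S).card + ((Finset.univ \ S).filter fun α => (Fin.rev α).val ≤ j.val).card = _ ↔ _
    have hiff : ((Finset.univ \ S).filter fun α => (Fin.rev α).val ≤ j.val).card = (Finset.univ \ S).card ↔ r ≤ j.val + (α₀.val + 1) := by
      rw [Finset.card_filter_eq_iff]
      constructor
      · intro h
        have := h α₀ (by simp [hα₀])
        rw [Fin.val_rev] at this
        omega
      · intro h α hα
        have := Fin.le_iff_val_le_val.1 (hmin α (by simpa using hα))
        rw [Fin.val_rev]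
        omega
    have h1 : ((Finset.univ \ S).filter fun α => (Fin.rev α).val ≤ j.val).card ≤ (Finset.univ \ S).card := Finset.card_filter_le _ _
    constructor
    · intro h; have := hiff.1 (by omega); omega
    · intro h; have := hiff.2 (by omega); omega

include hstd hα₀ hmin in
/-- The labelling of `S` refines the three blocks, any `m`. [cite: BernsteinZelevinsky1977, §2.1] -/
private theorem blockLabel_mono_of_wittBlockOn_le'' {k l : Fin N} (hkl : wittBlockOn e S k ≤ wittBlockOn e S l) :
    blockLabel N (α₀.val + 1) k ≤ blockLabel N (α₀.val + 1) l := by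
  have h0 := wittBlockNat_eq_zero_iff e hstd hα₀ hmin
  have h2 := wittBlockNat_eq_two_mul_iff'' e hstd hα₀ hmin
  rw [Fin.le_iff_val_le_val, wittBlockOn_apply, wittBlockOn_apply, wittBlock_val, wittBlock_val] at hkl
  have hk := wittBlockNat_le S (e.symm k)
  have hl := wittBlockNat_le S (e.symm l)
  have h0k := h0 (e.symm k); have h0l := h0 (e.symm l); have h2k := h2 (e.symm k); have h2l := h2 (e.symm l)
  rw [e.apply_symm_apply] at h0k h0l h2k h2l
  unfold blockLabel
  split_ifs <;> omega

include hstd hα₀ hmin in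
/-- Equal `S`-labels have equal `Q_{α₀+1}`-blocks, any `m`. [cite: BernsteinZelevinsky1977, §2.1] -/
private theorem blockLabel_eq_of_wittBlockOn_eq'' {k l : Fin N} (hkl : wittBlockOn e S k = wittBlockOn e S l) :
    blockLabel N (α₀.val + 1) k = blockLabel N (α₀.val + 1) l :=
  le_antisymm (blockLabel_mono_of_wittBlockOn_le'' e hstd hα₀ hmin hkl.le) (blockLabel_mono_of_wittBlockOn_le'' e hstd hα₀ hmin hkl.ge)

end Labels

/-! ## §2 The recursion in bounded currency -/

section Recursion

variable {K : Type*} [Field K] [Valued K ℤᵐ⁰] [IsPrincipalIdealRing (Valued.v (R := K)).valuationSubring] {σ : K →+* K} {ϖ : K} {m : ℕ} {Han : Matrix (Fin m) (Fin m) K}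

/-- **LEVI CARTAN DECOMPOSITION OF `U(σ, wittFormOn e Han)` FOR ANY KERNEL IN BOUNDED (compact-set) CURRENCY, modulo the bounded sorted Cartan letter `hrawBs`**
(the set-twin of ★ p856772): for every `(r, e, S)` there is `b : ℕ` such that every `g ∈ U(σ, W) ∩ M_S` is `k₁ · diag(d) · k₂` with `k₁, k₂ ∈ M_S`, entries of `k_i`,
`k_i⁻¹` bounded by `exp b`, `σ(d_i) d_{rev i} = 1`, `d ≡ 1` on the kernel, `|d_k| = q^{−E_k}`, `E` antitone on the `S`-blocks, `E ∘ rev = −E`.  Strong induction on `r`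
peeling the first `GL` block; the bound grows by `2 c_W` per level. [cite: BruhatTits1972, (4.4.3)] [cite: Tits1979, §3.3.3] [cite: Macdonald1995, Ch. V §2 (2.2)] -/
theorem exists_leviBounded_mul_diagonalGL_mul_kernel (hσ : ∀ x, σ (σ x) = x) (hvσ : ∀ x, Valued.v (σ x) = Valued.v x)
    (hϖ : Valued.v ϖ = WithZero.exp (-1 : ℤ)) (hHan : IsUnit Han.det)
    (hrawBs : ∀ (r' N' : ℕ) (e' : WittIndex r' m ≃ Fin N')
      (_hstd' : ∀ x, (e' x).val = Sum.elim (fun i : Fin r' => i.val) (Sum.elim (fun u : Fin m => r' + u.val) (fun j : Fin r' => r' + m + j.val)) x),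
      ∃ b : ℕ, ∀ g : unitaryGroupOfForm σ (wittFormOn e' Han), ∃ k₁ k₂ : unitaryGroupOfForm σ (wittFormOn e' Han),
        (∀ i j, Valued.v (((k₁ : GL (Fin N') K) : Matrix (Fin N') (Fin N') K) i j) ≤ WithZero.exp (b : ℤ)) ∧
        (∀ i j, Valued.v ((((k₁⁻¹ : unitaryGroupOfForm σ (wittFormOn e' Han)) : GL (Fin N') K) : Matrix (Fin N') (Fin N') K) i j) ≤ WithZero.exp (b : ℤ)) ∧
        (∀ i j, Valued.v (((k₂ : GL (Fin N') K) : Matrix (Fin N') (Fin N') K) i j) ≤ WithZero.exp (b : ℤ)) ∧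
        (∀ i j, Valued.v ((((k₂⁻¹ : unitaryGroupOfForm σ (wittFormOn e' Han)) : GL (Fin N') K) : Matrix (Fin N') (Fin N') K) i j) ≤ WithZero.exp (b : ℤ)) ∧
        ∃ (d : Fin N' → K) (E : Fin N' → ℤ), (((k₁ * g * k₂ : unitaryGroupOfForm σ (wittFormOn e' Han)) : GL (Fin N') K) : Matrix (Fin N') (Fin N') K) = Matrix.diagonal d ∧
          (∀ i, σ (d i) * d (Fin.rev i) = 1) ∧ (∀ u : Fin m, d (e' (Sum.inr (Sum.inl u))) = 1) ∧
          (∀ k, Valued.v (d k) = WithZero.exp (-E k)) ∧ (∀ i j : Fin N', i ≤ j → E j ≤ E i)) :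
    ∀ (r : ℕ) {N : ℕ} (e : WittIndex r m ≃ Fin N)
      (_hstd : ∀ x, (e x).val = Sum.elim (fun i : Fin r => i.val) (Sum.elim (fun u : Fin m => r + u.val) (fun j : Fin r => r + m + j.val)) x)
      (S : Finset (Fin r)), ∃ b : ℕ, ∀ (g : unitaryGroupOfForm σ (wittFormOn e Han))
      (_hgL : (g : GL (Fin N) K) ∈ standardLeviGL K (wittBlockOn e S)),
      ∃ k₁ k₂ : unitaryGroupOfForm σ (wittFormOn e Han),
        (∀ i j, Valued.v (((k₁ : GL (Fin N) K) : Matrix (Fin N) (Fin N) K) i j) ≤ WithZero.exp (b : ℤ)) ∧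
        (∀ i j, Valued.v ((((k₁⁻¹ : unitaryGroupOfForm σ (wittFormOn e Han)) : GL (Fin N) K) : Matrix (Fin N) (Fin N) K) i j) ≤ WithZero.exp (b : ℤ)) ∧
        (k₁ : GL (Fin N) K) ∈ standardLeviGL K (wittBlockOn e S) ∧
        (∀ i j, Valued.v (((k₂ : GL (Fin N) K) : Matrix (Fin N) (Fin N) K) i j) ≤ WithZero.exp (b : ℤ)) ∧
        (∀ i j, Valued.v ((((k₂⁻¹ : unitaryGroupOfForm σ (wittFormOn e Han)) : GL (Fin N) K) : Matrix (Fin N) (Fin N) K) i j) ≤ WithZero.exp (b : ℤ)) ∧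
        (k₂ : GL (Fin N) K) ∈ standardLeviGL K (wittBlockOn e S) ∧
        ∃ (d : Fin N → Kˣ) (E : Fin N → ℤ), (∀ i, σ (d i) * d (Fin.rev i) = 1) ∧ (∀ u : Fin m, d (e (Sum.inr (Sum.inl u))) = 1) ∧
          (∀ k, Valued.v (d k : K) = WithZero.exp (-E k)) ∧
          (∀ i j : Fin N, wittBlockOn e S i = wittBlockOn e S j → i ≤ j → E j ≤ E i) ∧ (∀ i, E (Fin.rev i) = -E i) ∧
          (g : GL (Fin N) K) = k₁ * diagonalGL (Fin N) K d * k₂ := by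
  have hϖ0 : ϖ ≠ 0 := uniformizer_ne_zero hϖ
  intro r
  induction r using Nat.strong_induction_on with
  | _ r IH =>
  intro N e hstd S
  have hN : N = r + (m + r) := by simpa using (Fintype.card_congr e).symm
  have hWunit : IsUnit (wittFormOn e Han).det := isUnit_det_wittFormOn e hHan
  by_cases hS : Finset.univ \ S = ∅
  · -- `S = univ`: the letter
    have hSu : S = Finset.univ := Finset.univ_subset_iff.1 (Finset.sdiff_eq_empty_iff_subset.1 hS)
    subst hSu
    have hlab : ∀ i j : Fin N, wittBlockOn e (Finset.univ : Finset (Fin r)) i = wittBlockOn e Finset.univ j := fun i j => by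
      rw [wittBlockOn_apply, wittBlockOn_apply, wittBlock_univ, wittBlock_univ]
    obtain ⟨b, hb⟩ := hrawBs r N e hstd
    refine ⟨b, fun g _ => ?_⟩
    obtain ⟨k₁, k₂, hk₁i, hk₁i', hk₂i, hk₂i', d₀, E, hdiag, hdn, hdker, hdv, hanti⟩ := hb g
    have hd0 : ∀ i, d₀ i ≠ 0 := fun i h0 => by
      have h := hdn (Fin.rev i)
      rw [Fin.rev_rev, h0, mul_zero] at h
      exact zero_ne_one h
    have hErev : ∀ i, E (Fin.rev i) = -E i := fun i => by
      have h := congrArg Valued.v (hdn i)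
      rw [map_mul, map_one, hvσ, hdv, hdv, ← WithZero.exp_add, ← WithZero.exp_zero, WithZero.exp_inj] at h
      omega
    obtain ⟨w, hw⟩ : ∃ w : Fin N → Kˣ, w = fun i => Units.mk0 (d₀ i) (hd0 i) := ⟨_, rfl⟩
    have hwval : ∀ i, (w i : K) = d₀ i := fun i => by rw [hw]; rfl
    have hD : ((k₁ * g * k₂ : unitaryGroupOfForm σ (wittFormOn e Han)) : GL (Fin N) K) = diagonalGL (Fin N) K w := Units.ext (by
      rw [hdiag, coe_diagonalGL]; exact congrArg Matrix.diagonal (funext fun i => (hwval i).symm))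
    refine ⟨k₁⁻¹, k₂⁻¹, hk₁i', by rw [inv_inv]; exact hk₁i, (mem_standardLeviGL_iff _ _).2 fun i j hij => absurd (hlab i j) hij,
      hk₂i', by rw [inv_inv]; exact hk₂i, (mem_standardLeviGL_iff _ _).2 fun i j hij => absurd (hlab i j) hij,
      w, E, fun i => by rw [hwval, hwval]; exact hdn i, fun u => Units.ext (by rw [hwval, Units.val_one]; exact hdker u),
      fun k => by rw [hwval]; exact hdv k, fun i j _ hij => hanti i j hij, hErev, ?_⟩
    rw [Subgroup.coe_inv, Subgroup.coe_inv, ← hD, Subgroup.coe_mul, Subgroup.coe_mul]; group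
  · -- the first break `α₀`, `c = α₀ + 1`
    have hne : (Finset.univ \ S).Nonempty := Finset.nonempty_iff_ne_empty.2 hS
    obtain ⟨α₀, hα₀mem, hα₀min⟩ : ∃ α₀ ∈ Finset.univ \ S, ∀ α ∈ Finset.univ \ S, α₀ ≤ α :=
      ⟨(Finset.univ \ S).min' hne, Finset.min'_mem _ hne, fun α hα => Finset.min'_le _ _ hα⟩
    have hα₀ : α₀ ∉ S := (Finset.mem_sdiff.1 hα₀mem).2
    have hmin : ∀ α, α ∉ S → α₀ ≤ α := fun α hα => hα₀min α (Finset.mem_sdiff.2 ⟨Finset.mem_univ _, hα⟩)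
    have hα₀r := α₀.isLt
    have hcr : α₀.val + 1 ≤ r := by omega
    have hc : 2 * (α₀.val + 1) ≤ N := by omega
    have hN' : (r - (α₀.val + 1)) + (m + (r - (α₀.val + 1))) = N - 2 * (α₀.val + 1) := by omega
    have hr' : r - (α₀.val + 1) < r := by omega
    obtain ⟨b', hb'⟩ := IH _ hr' (stdWittEquivFin (r - (α₀.val + 1)) m hN') (stdWittEquivFin_hstd (r - (α₀.val + 1)) m hN')
      (Finset.univ.filter fun α' : Fin (r - (α₀.val + 1)) => (⟨α'.val + (α₀.val + 1), by have := α'.isLt; omega⟩ : Fin r) ∈ S)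
    obtain ⟨c₁, hc₁⟩ := exists_nat_forall_v_apply_le_exp (wittFormOn e Han)
    obtain ⟨c₂, hc₂⟩ := exists_nat_forall_v_apply_le_exp (wittFormOn e Han)⁻¹
    refine ⟨b' + 2 * (c₁ + c₂), fun g hgL => ?_⟩
    have hWle : ∀ p q, Valued.v (wittFormOn e Han p q) ≤ WithZero.exp ((c₁ + c₂ : ℕ) : ℤ) := fun p q =>
      (hc₁ p q).trans (WithZero.exp_le_exp.2 (by push_cast; omega))
    have hWile : ∀ p q, Valued.v ((wittFormOn e Han)⁻¹ p q) ≤ WithZero.exp ((c₁ + c₂ : ℕ) : ℤ) := fun p q =>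
      (hc₂ p q).trans (WithZero.exp_le_exp.2 (by push_cast; omega))
    have hq : ((g : GL (Fin N) K) : Matrix (Fin N) (Fin N) K).BlockTriangular (blockLabel N (α₀.val + 1)) :=
      blockTriangular_of_mem_standardLeviGL' e hstd hα₀ hmin hgL
    have hM0 : ∀ {p q : Fin N}, blockLabel N (α₀.val + 1) p ≠ blockLabel N (α₀.val + 1) q → ((g : GL (Fin N) K) : Matrix (Fin N) (Fin N) K) p q = 0 :=
      fun hpq => apply_eq_zero_of_mem_standardLeviGL' e hstd hα₀ hmin hgL hpq
    have hgu : (((g : GL (Fin N) K) : Matrix (Fin N) (Fin N) K).map σ)ᵀ * wittFormOn e Han * ((g : GL (Fin N) K) : Matrix (Fin N) (Fin N) K) =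
        wittFormOn e Han := mem_unitaryGroupOfForm_iff.1 g.2
    obtain ⟨A, hA, hA'⟩ := exists_gl_coe_eq_loBlock hc (g : GL (Fin N) K) hq
    obtain ⟨κ₁, κ₂, hκ₁, hκ₂, lam, hlam, hAeq⟩ := exists_integral_mul_zpowDiagGL_antitone_mul hϖ A
    obtain ⟨g', hg'⟩ := exists_unitary_coe_eq_midBlock e hstd Han hcr hc hN' hHan g hq
    have hg'L := mem_standardLeviGL_of_coe_eq_midBlock' e hstd hα₀ hmin hc hN' hgL hg'
    obtain ⟨κ₁', κ₂', hκ₁', hκ₁'i, hκ₁'L, hκ₂', hκ₂'i, hκ₂'L, d', E', hd'n, hd'ker, hd'v, hE'anti, hE'rev, hg'eq⟩ := hb' g' hg'L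
    obtain ⟨E, hE⟩ : ∃ E : Fin N → ℤ, E = fun p => if h0 : p.val < α₀.val + 1 then lam ⟨p.val, h0⟩
        else if h1 : p.val + (α₀.val + 1) < N then E' ⟨p.val - (α₀.val + 1), by omega⟩ else -lam ⟨N - 1 - p.val, by omega⟩ := ⟨_, rfl⟩
    have hElo : ∀ i : Fin (α₀.val + 1), E (Fin.castLE (le_of_two_mul_le hc) i) = lam i := fun i => by
      rw [hE]; dsimp only; rw [dif_pos (by exact i.isLt)]
      exact congrArg lam (Fin.ext rfl)
    have hEmid : ∀ j : Fin (N - 2 * (α₀.val + 1)), E (midIndex hc j) = E' j := fun j => by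
      have hj := j.isLt
      have h1 : ¬ ((midIndex hc j).val < α₀.val + 1) := by rw [coe_midIndex]; omega
      have h2 : (midIndex hc j).val + (α₀.val + 1) < N := by rw [coe_midIndex]; omega
      rw [hE]; dsimp only; rw [dif_neg h1, dif_pos h2]
      congr 1; apply Fin.ext; change (midIndex hc j).val - (α₀.val + 1) = j.val; rw [coe_midIndex]; omega
    have hEhi : ∀ i : Fin (α₀.val + 1), E (hiIndex hc i) = -lam (Fin.rev i) := fun i => by
      have hi := i.isLt
      have h1 : ¬ ((hiIndex hc i).val < α₀.val + 1) := by rw [coe_hiIndex]; omega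
      have h2 : ¬ ((hiIndex hc i).val + (α₀.val + 1) < N) := by rw [coe_hiIndex]; omega
      rw [hE]; dsimp only; rw [dif_neg h1, dif_neg h2]
      congr 2; apply Fin.ext; change N - 1 - (hiIndex hc i).val = (Fin.rev i).val; rw [Fin.val_rev, coe_hiIndex]; omega
    have hErev : ∀ p, E (Fin.rev p) = -E p := by
      intro p
      obtain ⟨x, rfl⟩ := (blockSum hc).surjective p
      rcases x with (i | i) | i
      · rw [blockSum_inl_inl, rev_castLE hc, hEhi, Fin.rev_rev, hElo]
      · rw [blockSum_inl_inr, rev_midIndex hc, hEmid, hEmid, hE'rev]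
      · rw [blockSum_inr, rev_hiIndex hc, hElo, hEhi, neg_neg]
    have hEanti : ∀ i j : Fin N, wittBlockOn e S i = wittBlockOn e S j → i ≤ j → E j ≤ E i := by
      intro p q hlab hpq
      have hb := blockLabel_eq_of_wittBlockOn_eq'' e hstd hα₀ hmin hlab
      obtain ⟨x, rfl⟩ := (blockSum hc).surjective p
      obtain ⟨y, rfl⟩ := (blockSum hc).surjective q
      rcases x with (i | i) | i <;> rcases y with (j | j) | j <;>
        simp only [blockSum_inl_inl, blockSum_inl_inr, blockSum_inr, blockLabel_castLE hc, blockLabel_midIndex hc, blockLabel_hiIndex hc] at hb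
      all_goals first
        | exact absurd hb (by decide)
        | skip
      · rw [blockSum_inl_inl] at hpq ⊢; rw [blockSum_inl_inl] at hpq ⊢
        rw [hElo, hElo]
        exact hlam ((Fin.castLE_le_castLE_iff _).1 hpq)
      · rw [blockSum_inl_inr] at hlab hpq ⊢; rw [blockSum_inl_inr] at hlab hpq ⊢
        rw [hEmid, hEmid]
        refine hE'anti i j (Fin.ext ?_) (Fin.le_iff_val_le_val.2 ?_)
        · have h' := congrArg Fin.val hlab
          rw [wittBlockOn_apply, wittBlockOn_apply, wittBlock_val, wittBlock_val, wittBlockNat_symm_midIndex e hstd hα₀ hmin hc hN',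
            wittBlockNat_symm_midIndex e hstd hα₀ hmin hc hN'] at h'
          rw [wittBlockOn_apply, wittBlockOn_apply, wittBlock_val, wittBlock_val]
          omega
        · rw [Fin.le_iff_val_le_val, coe_midIndex, coe_midIndex] at hpq; omega
      · rw [blockSum_inr] at hpq ⊢; rw [blockSum_inr] at hpq ⊢
        rw [hEhi, hEhi, neg_le_neg_iff]
        refine hlam (Fin.rev_le_rev.2 (Fin.le_iff_val_le_val.2 ?_))
        rw [Fin.le_iff_val_le_val, coe_hiIndex, coe_hiIndex] at hpq; omega
    -- the glued diagonal: `ϖ^{lam}` on the first block, `d'` on the middle block, the last block forced by the norm condition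
    obtain ⟨d, hd⟩ : ∃ d : Fin N → Kˣ, d = fun p => if h0 : p.val < α₀.val + 1 then Units.mk0 ϖ hϖ0 ^ lam ⟨p.val, h0⟩
        else if h1 : p.val + (α₀.val + 1) < N then d' ⟨p.val - (α₀.val + 1), by omega⟩
        else (Units.map (σ : K →* K) (Units.mk0 ϖ hϖ0 ^ lam ⟨N - 1 - p.val, by omega⟩))⁻¹ := ⟨_, rfl⟩
    have hdlo : ∀ i : Fin (α₀.val + 1), d (Fin.castLE (le_of_two_mul_le hc) i) = Units.mk0 ϖ hϖ0 ^ lam i := fun i => by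
      rw [hd]; dsimp only; rw [dif_pos (by exact i.isLt)]
      exact congrArg (fun k => Units.mk0 ϖ hϖ0 ^ lam k) (Fin.ext rfl)
    have hdmid : ∀ j : Fin (N - 2 * (α₀.val + 1)), d (midIndex hc j) = d' j := fun j => by
      have hj := j.isLt
      have h1 : ¬ ((midIndex hc j).val < α₀.val + 1) := by rw [coe_midIndex]; omega
      have h2 : (midIndex hc j).val + (α₀.val + 1) < N := by rw [coe_midIndex]; omega
      rw [hd]; dsimp only; rw [dif_neg h1, dif_pos h2]
      congr 1; apply Fin.ext; change (midIndex hc j).val - (α₀.val + 1) = j.val; rw [coe_midIndex]; omega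
    have hdhi : ∀ i : Fin (α₀.val + 1), d (hiIndex hc i) = (Units.map (σ : K →* K) (Units.mk0 ϖ hϖ0 ^ lam (Fin.rev i)))⁻¹ := fun i => by
      have hi := i.isLt
      have h1 : ¬ ((hiIndex hc i).val < α₀.val + 1) := by rw [coe_hiIndex]; omega
      have h2 : ¬ ((hiIndex hc i).val + (α₀.val + 1) < N) := by rw [coe_hiIndex]; omega
      rw [hd]; dsimp only; rw [dif_neg h1, dif_neg h2]
      have hidx : (⟨N - 1 - (hiIndex hc i).val, by rw [coe_hiIndex]; omega⟩ : Fin (α₀.val + 1)) = Fin.rev i :=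
        Fin.ext (by change N - 1 - (hiIndex hc i).val = (Fin.rev i).val; rw [Fin.val_rev, coe_hiIndex]; omega)
      rw [hidx]
    have hdn : ∀ p, σ (d p) * d (Fin.rev p) = 1 := by
      intro p
      obtain ⟨x, rfl⟩ := (blockSum hc).surjective p
      rcases x with (i | i) | i
      · rw [blockSum_inl_inl, rev_castLE hc, hdhi, Fin.rev_rev, hdlo,
          show σ ((Units.mk0 ϖ hϖ0 ^ lam i : Kˣ) : K) = ((Units.map (σ : K →* K) (Units.mk0 ϖ hϖ0 ^ lam i) : Kˣ) : K) from rfl,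
          ← Units.val_mul, mul_inv_cancel, Units.val_one]
      · rw [blockSum_inl_inr, rev_midIndex hc, hdmid, hdmid]; exact hd'n i
      · rw [blockSum_inr, rev_hiIndex hc, hdhi, hdlo, Units.val_inv_eq_inv_val,
          show ((Units.map (σ : K →* K) (Units.mk0 ϖ hϖ0 ^ lam (Fin.rev i)) : Kˣ) : K) = σ ((Units.mk0 ϖ hϖ0 ^ lam (Fin.rev i) : Kˣ) : K) from rfl,
          map_inv₀, hσ, inv_mul_cancel₀ (Units.ne_zero _)]
    have hdker : ∀ u : Fin m, d (e (Sum.inr (Sum.inl u))) = 1 := fun u => by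
      rw [← midIndex_stdWittEquivFin_kernel e hstd hcr hc hN' u, hdmid]; exact hd'ker u
    have hdv : ∀ p, Valued.v (d p : K) = WithZero.exp (-E p) := by
      intro p
      obtain ⟨x, rfl⟩ := (blockSum hc).surjective p
      rcases x with (i | i) | i
      · rw [blockSum_inl_inl, hdlo, hElo, Units.val_zpow_eq_zpow_val, Units.val_mk0, v_uniformizer_zpow hϖ]
      · rw [blockSum_inl_inr, hdmid, hEmid]; exact hd'v i
      · rw [blockSum_inr, hdhi, hEhi, neg_neg, Units.val_inv_eq_inv_val,
          show ((Units.map (σ : K →* K) (Units.mk0 ϖ hϖ0 ^ lam (Fin.rev i)) : Kˣ) : K) = σ ((Units.mk0 ϖ hϖ0 ^ lam (Fin.rev i) : Kˣ) : K) from rfl,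
          map_inv₀, hvσ, Units.val_zpow_eq_zpow_val, Units.val_mk0, v_uniformizer_zpow hϖ, ← WithZero.exp_neg, neg_neg]
    -- the diagonal `D = diag(d)` is `W`-unitary (hyperbolic pairs by the norm condition, kernel slots by `d ≡ 1`)
    have hDU : diagonalGL (Fin N) K d ∈ unitaryGroupOfForm σ (wittFormOn e Han) := by
      have hD : diagonalGL (Fin N) K d = glDiagonal N K d := Units.ext (by rw [coe_diagonalGL, coe_glDiagonal])
      rw [hD]
      refine glDiagonal_mem_unitaryGroupOfForm σ (wittFormOn e Han) d fun a b hab => ?_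
      obtain ⟨x, rfl⟩ := e.surjective a
      rcases x with i | u | j
      · rw [wittFormOn_apply_inl e hstd Han] at hab
        by_cases h : b = Fin.rev (e (Sum.inl i))
        · rw [h]; exact hdn _
        · exact absurd (if_neg h) hab
      · rw [wittFormOn_apply_inr_inl e Han] at hab
        obtain ⟨y, rfl⟩ := e.surjective b
        rw [e.symm_apply_apply] at hab
        rcases y with i' | u' | j'
        · exact absurd rfl hab
        · rw [hdker, hdker, Units.val_one, map_one, one_mul]
        · exact absurd rfl hab
      · rw [wittFormOn_apply_inr_inr e hstd Han] at hab
        by_cases h : b = Fin.rev (e (Sum.inr (Sum.inr j)))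
        · rw [h]; exact hdn _
        · exact absurd (if_neg h) hab
    obtain ⟨L₁, hL₁⟩ := exists_unitary_coe_eq_blockDiagMatrix e hstd Han hcr hc hN' hσ hHan κ₁ κ₁'
    obtain ⟨L₂, hL₂⟩ := exists_unitary_coe_eq_blockDiagMatrix e hstd Han hcr hc hN' hσ hHan κ₂ κ₂'
    have hL₁t : ((L₁ : GL (Fin N) K) : Matrix (Fin N) (Fin N) K).BlockTriangular (blockLabel N (α₀.val + 1)) := by
      rw [hL₁]; exact blockTriangular_blockDiagMatrix hc _ _ _
    have hL₂t : ((L₂ : GL (Fin N) K) : Matrix (Fin N) (Fin N) K).BlockTriangular (blockLabel N (α₀.val + 1)) := by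
      rw [hL₂]; exact blockTriangular_blockDiagMatrix hc _ _ _
    have hL₁t' : ((L₁ : GL (Fin N) K) : Matrix (Fin N) (Fin N) K).BlockTriangular (OrderDual.toDual ∘ blockLabel N (α₀.val + 1)) := by
      rw [hL₁]; exact blockTriangular_toDual_of_apply_eq_zero fun hpq => blockDiagMatrix_apply_of_ne hc _ _ _ hpq
    have hL₂t' : ((L₂ : GL (Fin N) K) : Matrix (Fin N) (Fin N) K).BlockTriangular (OrderDual.toDual ∘ blockLabel N (α₀.val + 1)) := by
      rw [hL₂]; exact blockTriangular_toDual_of_apply_eq_zero fun hpq => blockDiagMatrix_apply_of_ne hc _ _ _ hpq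
    have hDt : ((diagonalGL (Fin N) K d : GL (Fin N) K) : Matrix (Fin N) (Fin N) K).BlockTriangular (blockLabel N (α₀.val + 1)) := by
      rw [coe_diagonalGL]; exact Matrix.blockTriangular_diagonal _
    have hDt' : ((diagonalGL (Fin N) K d : GL (Fin N) K) : Matrix (Fin N) (Fin N) K).BlockTriangular (OrderDual.toDual ∘ blockLabel N (α₀.val + 1)) := by
      rw [coe_diagonalGL]; exact Matrix.blockTriangular_diagonal _
    set P : ↥(unitaryGroupOfForm σ (wittFormOn e Han)) := L₁ * ⟨diagonalGL (Fin N) K d, hDU⟩ * L₂ with hPdef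
    have hPmat : ((P : GL (Fin N) K) : Matrix (Fin N) (Fin N) K) =
        ((L₁ : GL (Fin N) K) : Matrix (Fin N) (Fin N) K) * ((diagonalGL (Fin N) K d : GL (Fin N) K) : Matrix (Fin N) (Fin N) K) *
          ((L₂ : GL (Fin N) K) : Matrix (Fin N) (Fin N) K) := by
      rw [hPdef, Subgroup.coe_mul, Subgroup.coe_mul, Units.val_mul, Units.val_mul]
    have hPu : (((P : GL (Fin N) K) : Matrix (Fin N) (Fin N) K).map σ)ᵀ * wittFormOn e Han * ((P : GL (Fin N) K) : Matrix (Fin N) (Fin N) K) =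
        wittFormOn e Han := mem_unitaryGroupOfForm_iff.1 P.2
    have hP0 : ∀ {p q : Fin N}, blockLabel N (α₀.val + 1) p ≠ blockLabel N (α₀.val + 1) q → ((P : GL (Fin N) K) : Matrix (Fin N) (Fin N) K) p q = 0 :=
      fun hpq => by rw [hPmat]; exact apply_mul_mul_eq_zero_of_blockLabel_ne hL₁t hL₁t' hDt hDt' hL₂t hL₂t' hpq
    have hlo : loBlock hc ((g : GL (Fin N) K) : Matrix (Fin N) (Fin N) K) = loBlock hc ((P : GL (Fin N) K) : Matrix (Fin N) (Fin N) K) := by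
      rw [hPmat, loBlock_mul hc _ hL₂t, loBlock_mul hc _ hDt, hL₁, hL₂, loBlock_blockDiagMatrix, loBlock_blockDiagMatrix, coe_diagonalGL,
        loBlock_diagonal, ← hA, hAeq, Units.val_mul, Units.val_mul, coe_zpowDiagGL]
      congr 2
      exact congrArg Matrix.diagonal (funext fun i => by
        rw [Function.comp_apply, hdlo, Units.val_zpow_eq_zpow_val, Units.val_mk0])
    have hmid : midBlock hc ((g : GL (Fin N) K) : Matrix (Fin N) (Fin N) K) = midBlock hc ((P : GL (Fin N) K) : Matrix (Fin N) (Fin N) K) := by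
      rw [hPmat, midBlock_mul hc (hL₁t.mul hDt) hL₂t, midBlock_mul hc hL₁t hDt, hL₁, hL₂, midBlock_blockDiagMatrix, midBlock_blockDiagMatrix,
        coe_diagonalGL, midBlock_diagonal, ← hg', hg'eq, Units.val_mul, Units.val_mul, coe_diagonalGL]
      congr 2
      exact congrArg Matrix.diagonal (funext fun j => by rw [Function.comp_apply, hdmid])
    have heq : ((g : GL (Fin N) K) : Matrix (Fin N) (Fin N) K) = ((P : GL (Fin N) K) : Matrix (Fin N) (Fin N) K) :=
      eq_of_loBlock_eq_of_midBlock_eq_witt σ e hstd Han hcr hc hgu hPu hM0 hP0 hlo hmid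
    -- bounds of the lifts: `κ^{±1} ≤ 1`, `κ′ ≤ exp b′` ⇒ `L ≤ exp b′`; `L⁻¹ = W⁻¹ σ(L)ᵀ W ≤ exp(b′ + 2 c_W)`
    have hb'1 : (1 : ℤᵐ⁰) ≤ WithZero.exp (b' : ℤ) := by rw [← WithZero.exp_zero, WithZero.exp_le_exp]; exact_mod_cast Nat.zero_le b'
    have hLbd : ∀ {κ : GL (Fin (α₀.val + 1)) K} {κ' : ↥(unitaryGroupOfForm σ (wittFormOn (stdWittEquivFin (r - (α₀.val + 1)) m hN') Han))}
        {L : ↥(unitaryGroupOfForm σ (wittFormOn e Han))},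
        κ ∈ valuedCongruenceSubgroup (Fin (α₀.val + 1)) (1 : ℤᵐ⁰) →
        (∀ i j, Valued.v (((κ' : GL (Fin (N - 2 * (α₀.val + 1))) K) : Matrix (Fin (N - 2 * (α₀.val + 1))) (Fin (N - 2 * (α₀.val + 1))) K) i j) ≤ WithZero.exp (b' : ℤ)) →
        ((L : GL (Fin N) K) : Matrix (Fin N) (Fin N) K) = blockDiagMatrix hc (κ : Matrix _ _ K)
          ((κ' : GL (Fin (N - 2 * (α₀.val + 1))) K) : Matrix _ _ K) (dualBlock σ ((κ⁻¹ : GL _ K) : Matrix _ _ K)) →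
        ∀ p q, Valued.v (((L : GL (Fin N) K) : Matrix (Fin N) (Fin N) K) p q) ≤ WithZero.exp (b' : ℤ) := by
      intro κ κ' L hκ hκ' hL p q
      rw [hL]
      by_cases hpq : blockLabel N (α₀.val + 1) p = blockLabel N (α₀.val + 1) q
      · obtain ⟨x, rfl⟩ := (blockSum hc).surjective p
        obtain ⟨y, rfl⟩ := (blockSum hc).surjective q
        rcases x with (x | x) | x <;> rcases y with (y | y) | y <;>
          simp only [blockSum_inl_inl, blockSum_inl_inr, blockSum_inr, blockLabel_castLE hc, blockLabel_midIndex hc, blockLabel_hiIndex hc] at hpq ⊢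
        all_goals first
          | (rw [blockDiagMatrix_castLE_castLE hc]; exact (hκ.1 _ _).trans hb'1)
          | (rw [blockDiagMatrix_midIndex_midIndex hc]; exact hκ' _ _)
          | (rw [blockDiagMatrix_hiIndex_hiIndex hc, dualBlock_apply, hvσ]; exact (hκ.2.1 _ _).trans hb'1)
          | exact absurd hpq (by decide)
      · rw [blockDiagMatrix_apply_of_ne hc _ _ _ hpq, map_zero]; exact zero_le
    have hexp3 : WithZero.exp ((c₁ + c₂ : ℕ) : ℤ) * WithZero.exp (b' : ℤ) * WithZero.exp ((c₁ + c₂ : ℕ) : ℤ) ≤ WithZero.exp ((b' + 2 * (c₁ + c₂) : ℕ) : ℤ) := by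
      rw [← WithZero.exp_add, ← WithZero.exp_add, WithZero.exp_le_exp]; push_cast; omega
    have hexp1 : WithZero.exp (b' : ℤ) ≤ WithZero.exp ((b' + 2 * (c₁ + c₂) : ℕ) : ℤ) := by rw [WithZero.exp_le_exp]; push_cast; omega
    have hL₁b := hLbd hκ₁ hκ₁' hL₁
    have hL₂b := hLbd hκ₂ hκ₂' hL₂
    refine ⟨L₁, L₂, fun i j => (hL₁b i j).trans hexp1, fun i j => ?_, mem_standardLeviGL_of_coe_eq_blockDiagMatrix' e hstd hα₀ hmin hc hN' _ _ hκ₁'L hL₁,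
      fun i j => (hL₂b i j).trans hexp1, fun i j => ?_, mem_standardLeviGL_of_coe_eq_blockDiagMatrix' e hstd hα₀ hmin hc hN' _ _ hκ₂'L hL₂,
      d, E, hdn, hdker, hdv, hEanti, hErev, ?_⟩
    · rw [Subgroup.coe_inv]; exact (v_inv_apply_le_of_v_apply_le hvσ hWunit hWle hWile L₁ hL₁b i j).trans hexp3
    · rw [Subgroup.coe_inv]; exact (v_inv_apply_le_of_v_apply_le hvσ hWunit hWle hWile L₂ hL₂b i j).trans hexp3
    calc (g : GL (Fin N) K) = (P : GL (Fin N) K) := Units.ext heq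
      _ = (L₁ : GL (Fin N) K) * diagonalGL (Fin N) K d * (L₂ : GL (Fin N) K) := by rw [hPdef, Subgroup.coe_mul, Subgroup.coe_mul]

end Recursion

end Summit.HodgeConjecture.HodgeConjecture.Cruxes.H413.K2E3WittLeviCartanRecursionBounded

end
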